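import Summits.QuantumFields.BalabanUV.Beta.GAN24.SrecWilsonSector
import Summits.QuantumFields.BalabanUV.Beta.GAN24.TaylorRowW
import Summits.QuantumFields.BalabanUV.Beta.GAN24.RespStepDecay

/-!
# `BalabanUV.Beta.GAN24.WilsonSectorUndressedRow` — binder row G-an2-4 / (CONV-C), CT-ROUTE, the hS0 ASSEMBLY for the cubic-WILSON sector of (E),
# part A (row owner, `gen19/CT3-MECHANISM-v1.2.md` §B∕§C): (E-α-B) THE ONE-SHOT THIRD JET IS ONE THREE-LEG PUSH THROUGH THE UNDRESSED LEGS
# `B = respStep 1 N`, and ROAD S3's WILSON ROW `TaylorRowW.rowW_three` READ IN `push₃` CURRENCY WITH THE RECURSIVE FAMILY's UNIT WEIGHT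
# `cE·(cE·Lc^{2(d+1)})^{k+1}` (leaf-03's `SrecWilsonSector.unitS_wilsonSecAt_succ_eq_push₃`) AT THE PIN `cE = Lc^{d+1}` — uniformly in the level

NOT IN PRINT; OUR PROOF ATTEMPT (of the route; THIS file is [folklore] bookkeeping: an5's one-shot block dictionary `KInv_inl_inr_coarse` ∕
`KInv_inr_inl_coarse` ∕ `GamΦ_eq_neg_wH`, leaf-01's `SrecLinearPartEq.e3K_eq_neg_push₃_of_isFF` and `Push3.push₃_smul` ∕ `Push3LegTelescope.push₃_neg_left`,
leaf-05's `ThirdJetKernel.e3OfS_eq_e3K`, road S3's ROW W `TaylorRowW.rowW_three` (the analytic content: (N1)∕(N1′) + the Wilson charge-zero sum rule) BY NAME,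
and scalar arithmetic at the pin).  HONEST FRAMING (cell contract, verbatim): «discharging `BetaPertH` makes Bałaban's UV stability UNCONDITIONAL — a real
constructive-QFT result; it is NOT the continuum limit and NOT the Clay problem.»  HONEST DEPENDENCY (verbatim): «continuum YM on T⁴ ⇐ BetaPertH ∧ nine spine
estimates (0/9 proved); BetaPertH ⇐ (D1) ∧ (D4) ∧ CAP+tail; G-an2-4 gates asym, D1 and NE2/3/4.»  No cited fact, no wall binder, no `def`, no `def … : Prop`.
Discharges NOTHING of (hS, hSall) on (E) by itself: it is the UNDRESSED half of hS0 for the Wilson sector; the other half is the contact term (leaf-01's CT-3c END,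
`ContactKernelCells` + assembly) — part B of this assembly adds it.  NEVER «G-an2-4 closed»; NOT `BetaPertH`, NOT continuum, NOT Clay.

## What is proved
* §1 (generic `d`, any blocking `N ≥ 1`) `colH_KInv_eq_respStep_one` (`colH (KInv N) N = respStep 1 N`), `rowM_KInv_eq_neg_respStep_one`
  (`rowM (KInv N) N = −respStep 1 N`, an5's `ℋ♭ = −ℋᵀ`), **`e3OfS_eq_push₃`** — (E-α-B): for an ff-valued stencil family
  `e3OfS N S κ′ u′ = push₃ B B B S κ′ u′`, `B = respStep 1 N` (the two signs `rowM = −B` and `e3K = −push₃` cancel), `e3OfS_smul_eq_push₃`.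
* §2 (`d = 3`, every `Lc ≥ 1`) **`rowW_push₃`**: road S3's ROW W in push currency —
  `∃ CW δW, 0 < δW ∧ ∀ n, LocStencil (fun κ′ u′ => ((Lc^(n+2))^8·(cE·Lc^{4(n+1)})) • push₃ B B B (wilsonA 3) κ′ u′) CW δW`, `B = respStep 1 (Lc^(n+2))`.
* §3 (`d = 3`, every `Lc ≥ 1`, THE PIN `cE = Lc^4` of the literal (an2's Ward lock `stepLocks_bcj_iff`)) **`exists_locStencil_wilsonUndressed_pin`**:
  `∃ C δ, 0 < δ ∧ ∀ k, LocStencil (fun κ′ u′ => (cE·(cE·Lc^8)^(k+1)) • push₃ B_k B_k B_k (wilsonA 3) κ′ u′) C δ`, `B_k = respStep 1 (Lc^(k+1))` — the unit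
  weight of `unitS_wilsonSecAt_succ_eq_push₃` on the UNDRESSED legs is road S3's row W times the CONSTANT `Lc^4` (`k ≥ 1`; the member `k = 0` by the
  locality of one `e3OfS`): the undressed half of hS0 for the Wilson lineage, uniformly in `k`.
Unit `b2b-balaban-gan24-p1` (row owner G-an2-4, gen 19), 2026-08-21.
-/

noncomputable section

open Finset
open scoped BigOperators
open Literature.MathematicalPhysics.QuantumFieldTheory
open Literature.MathematicalPhysics.QuantumFieldTheory.Balaban1983to89
open Literature.MathematicalPhysics.QuantumFieldTheory.Balaban1983to89.Beta
open ExpKernelCalculus (MKer Decays)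
open OneStepResolventKernel (Fib LocStencil KInv KInv_inl_inr_coarse KInv_inr_inl_coarse decays_KInv)
open OneStepKernelFamily (colH)
open StepJetData (wilsonA locStencil_wilsonA locStencil_add locStencil_smul)
open BalabanStepJets (locStencil_mono)
open AffineAveraging (box toSite)
open ResolventComposition (GamΦ_eq_neg_wH)
open BalabanCompositeJets (respStep)
open Summit.QuantumFields.BalabanUV.Beta.SpineRooted (e3OfK locStencil_e3OfK)
open Summit.QuantumFields.BalabanUV.Beta.GAN24.Push4 (rowM rowM_apply colH_apply' IsFF)
open Summit.QuantumFields.BalabanUV.Beta.GAN24.Push3 (push₃ push₃_smul)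
open Summit.QuantumFields.BalabanUV.Beta.GAN24.Push3LegTelescope (push₃_neg_left)
open Summit.QuantumFields.BalabanUV.Beta.GAN24.E3UnitSplit (e3OfS)
open Summit.QuantumFields.BalabanUV.Beta.GAN24.ThirdJetKernel (e3K e3OfS_eq_e3K)
open Summit.QuantumFields.BalabanUV.Beta.GAN24.CubicReadoutDecLift (e3OfK_eq_e3K)
open Summit.QuantumFields.BalabanUV.Beta.GAN24.SrecLinearPartEq (e3K_eq_neg_push₃_of_isFF)
open Summit.QuantumFields.BalabanUV.Beta.GAN24.SrecWilsonSector (isFF_wilsonA isFF_smul)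
open Summit.QuantumFields.BalabanUV.Beta.GAN24.RespStepDecay (respStep_one)
open Summit.QuantumFields.BalabanUV.Beta.GAN24.TaylorRowW (rowW_three)
open Summit.QuantumFields.BalabanUV.Beta.GAN24.StencilSlotOfShapes (locStencil_mono')

namespace Summit.QuantumFields.BalabanUV.Beta.GAN24.WilsonSectorUndressedRow

variable {d : ℕ}

/-! ## §1 (E-α-B): the one-shot third jet is ONE three-leg push through the undressed legs `B = respStep 1 N` -/

section OneShot

variable {N : ℕ} [NeZero N]

/-- [folklore] The column leg of the one-shot packed resolvent is the (K1b′) response family at `M = 1`: `colH (KInv N) N = respStep 1 N`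
(an5's `KInv_inl_inr_coarse` + leaf-12's `respStep_one`). -/
theorem colH_KInv_eq_respStep_one : colH (KInv (N := N) (d := d)) N = respStep (d := d) 1 N := by
  funext μ z κ u
  rw [colH_apply', KInv_inl_inr_coarse, respStep_one]

/-- [folklore] The row leg of the one-shot packed resolvent is MINUS the response family: `rowM (KInv N) N = −respStep 1 N`
(an5's `KInv_inr_inl_coarse` + `GamΦ_eq_neg_wH`: `ℋ♭ = −ℋᵀ`). -/
theorem rowM_KInv_eq_neg_respStep_one : rowM (KInv (N := N) (d := d)) N = -respStep (d := d) 1 N := by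
  funext α x' κ x
  rw [rowM_apply, KInv_inr_inl_coarse, GamΦ_eq_neg_wH, Pi.neg_apply, Pi.neg_apply, Pi.neg_apply, Pi.neg_apply, respStep_one]

/-- NOT IN PRINT; OUR BOOKKEEPING.  **(E-α-B) — THE ONE-SHOT THIRD JET OF AN ff-VALUED STENCIL FAMILY IS ONE THREE-LEG PUSH THROUGH THE UNDRESSED LEGS**:
`e3OfS N S κ′ u′ = push₃ B B B S κ′ u′`, `B = respStep 1 N` (leaf-05's `e3OfS_eq_e3K`, leaf-01's `e3K_eq_neg_push₃_of_isFF`, the leg dictionary above; the signs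
`rowM = −B` and `e3K = −push₃` cancel).  The socket between road S3's one-shot rows and leaf-01 g58's `ContactKernelCells` (whose undressed legs at `m = 0` are
`respStep (Lc^0) (Lc^(0+k+1)) = respStep 1 (Lc^(k+1))`). -/
theorem e3OfS_eq_push₃ {S : Fin (d + 1) → (Fin (d + 1) → ℤ) → MKer (d + 1) (Fib d)} (hS : ∀ κ u, IsFF (S κ u))
    (κ' : Fin (d + 1)) (u' : Fin (d + 1) → ℤ) :
    e3OfS N S κ' u' = push₃ (respStep (d := d) 1 N) (respStep (d := d) 1 N) (respStep (d := d) 1 N) S κ' u' := by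
  rw [e3OfS_eq_e3K, e3K_eq_neg_push₃_of_isFF _ _ hS, rowM_KInv_eq_neg_respStep_one, colH_KInv_eq_respStep_one, push₃_neg_left, neg_neg]

/-- [folklore] … with a scalar weight on the table: `e3OfS N (c • S) κ′ u′ = c • push₃ B B B S κ′ u′`. -/
theorem e3OfS_smul_eq_push₃ {S : Fin (d + 1) → (Fin (d + 1) → ℤ) → MKer (d + 1) (Fib d)} (hS : ∀ κ u, IsFF (S κ u)) (c : ℝ)
    (κ' : Fin (d + 1)) (u' : Fin (d + 1) → ℤ) :
    e3OfS N (fun κ u => c • S κ u) κ' u' = c • push₃ (respStep (d := d) 1 N) (respStep (d := d) 1 N) (respStep (d := d) 1 N) S κ' u' := by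
  have hcS : ∀ κ u, IsFF (c • S κ u) := fun κ u => isFF_smul (hS κ u) c
  rw [e3OfS_eq_push₃ hcS, push₃_smul]

end OneShot

/-! ## §2 `d = 3`: road S3's row W in `push₃` currency -/

section Four

variable {Lc : ℕ} [NeZero Lc]

/-- NOT IN PRINT; OUR PROOF ATTEMPT (road S3's ROW W `TaylorRowW.rowW_three` BY NAME, re-read through (E-α-B)).  **ROW W IN PUSH CURRENCY**
(`d = 3`, every `Lc ≥ 1`, every `cE`): ONE rate `δW > 0` and ONE constant `CW` with, for ALL `n`,
`LocStencil (fun κ′ u′ => ((Lc^(n+2))^8·(cE·Lc^{4(n+1)})) • push₃ B B B (wilsonA 3) κ′ u′) CW δW`, `B = respStep 1 (Lc^(n+2))`. -/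
theorem rowW_push₃ (cE : ℝ) :
    ∃ CW δW : ℝ, 0 < δW ∧ ∀ n : ℕ, LocStencil (fun κ' u' =>
      (((Lc : ℝ) ^ (n + 1 + 1)) ^ (2 * (3 + 1)) * (cE * ((Lc : ℝ) ^ (3 + 1)) ^ (n + 1))) •
        push₃ (respStep (d := 3) 1 (Lc ^ (n + 1 + 1))) (respStep (d := 3) 1 (Lc ^ (n + 1 + 1))) (respStep (d := 3) 1 (Lc ^ (n + 1 + 1)))
          (wilsonA 3) κ' u') CW δW := by
  obtain ⟨CW, δW, hδW, hW⟩ := rowW_three (Lc := Lc) cE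
  refine ⟨CW, δW, hδW, fun n => ?_⟩
  have e : (fun κ' u' => (((Lc : ℝ) ^ (n + 1 + 1)) ^ (2 * (3 + 1)) * (cE * ((Lc : ℝ) ^ (3 + 1)) ^ (n + 1))) •
        push₃ (respStep (d := 3) 1 (Lc ^ (n + 1 + 1))) (respStep (d := 3) 1 (Lc ^ (n + 1 + 1))) (respStep (d := 3) 1 (Lc ^ (n + 1 + 1)))
          (wilsonA 3) κ' u')
      = (fun κ' u' x' z' a b => ((Lc : ℝ) ^ (n + 1 + 1)) ^ (2 * (3 + 1)) *
          e3OfS (Lc ^ (n + 1 + 1)) (fun κ u => (cE * ((Lc : ℝ) ^ (3 + 1)) ^ (n + 1)) • wilsonA 3 κ u) κ' u' x' z' a b) := by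
    funext κ' u' x' z' a b
    rw [e3OfS_smul_eq_push₃ (isFF_wilsonA (d := 3)), Pi.smul_apply, Pi.smul_apply, Pi.smul_apply, Pi.smul_apply, smul_eq_mul,
      Pi.smul_apply, Pi.smul_apply, Pi.smul_apply, Pi.smul_apply, smul_eq_mul, mul_assoc]
  rw [e]
  exact hW n

/-- NOT IN PRINT; OUR PROOF ATTEMPT.  **THE UNDRESSED HALF OF hS0 FOR THE WILSON LINEAGE OF (E), AT THE PIN `cE = Lc^4`** (`d = 3`, every `Lc ≥ 1`): ONE
rate `δ > 0` and ONE constant `C` with, for ALL `k`,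
`LocStencil (fun κ′ u′ => (cE·(cE·Lc^8)^(k+1)) • push₃ B_k B_k B_k (wilsonA 3) κ′ u′) C δ`, `B_k = respStep 1 (Lc^(k+1))` — the weight is EXACTLY that of
leaf-03's `SrecWilsonSector.unitS_wilsonSecAt_succ_eq_push₃` (`cE·(cE·Lc^{2(d+1)})^{k+1}` at `d = 3`), the legs are the UNDRESSED one-shot legs of leaf-01's
`ContactKernelCells.contact_legChain_ff_eq_cells` at `m = 0` (`respStep (Lc^0) (Lc^(0+k+1))`, `pow_zero` ∕ `zero_add`).  For `k ≥ 1` this family is `Lc^4 •` road S3's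
row W member (`rowW_push₃` at `n = k − 1`: `cE·(cE·Lc^8)^(k+1) = Lc^4·((Lc^(k+1))^8·(cE·Lc^{4k}))` at the pin); the member `k = 0` is local by an2's
`locStencil_e3OfK` (one `e3OfS` through the decaying `KInv Lc`).  With the contact term (CT-3c) added this becomes hS0 for the Wilson sector. -/
theorem exists_locStencil_wilsonUndressed_pin {cE : ℝ} (hcE : cE = (Lc : ℝ) ^ (3 + 1)) :
    ∃ C δ : ℝ, 0 < δ ∧ ∀ k : ℕ, LocStencil (fun κ' u' =>
      (cE * (cE * (Lc : ℝ) ^ (2 * (3 + 1))) ^ (k + 1)) •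
        push₃ (respStep (d := 3) 1 (Lc ^ (k + 1))) (respStep (d := 3) 1 (Lc ^ (k + 1))) (respStep (d := 3) 1 (Lc ^ (k + 1)))
          (wilsonA 3) κ' u') C δ := by
  have hL : (0 : ℝ) < (Lc : ℝ) := by exact_mod_cast Nat.pos_of_ne_zero (NeZero.ne Lc)
  obtain ⟨CW, δW, hδW, hW⟩ := rowW_push₃ (Lc := Lc) cE
  -- the member `k = 0`: one `e3OfS` at blocking `Lc`, local by an2's `locStencil_e3OfK`
  have h0S : LocStencil (fun κ u => (cE * (cE * (Lc : ℝ) ^ (2 * (3 + 1))) ^ (0 + 1)) • wilsonA 3 κ u)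
      (|cE * (cE * (Lc : ℝ) ^ (2 * (3 + 1))) ^ (0 + 1)| * _) 1 := locStencil_smul _ (locStencil_wilsonA (d := 3) zero_le_one)
  obtain ⟨δK, CK, hδK, hCK, hK⟩ := decays_KInv (N := Lc ^ (0 + 1)) (d := 3)
  obtain ⟨C₀, δ₀, hδ₀, h0⟩ := locStencil_e3OfK (N := Lc ^ (0 + 1)) (Nat.one_le_pow _ _ (Nat.pos_of_ne_zero (NeZero.ne Lc)))
    ⟨δK, CK, hδK, hCK, hK⟩ h0S one_pos
  have e0 : (fun κ' u' => (cE * (cE * (Lc : ℝ) ^ (2 * (3 + 1))) ^ (0 + 1)) •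
        push₃ (respStep (d := 3) 1 (Lc ^ (0 + 1))) (respStep (d := 3) 1 (Lc ^ (0 + 1))) (respStep (d := 3) 1 (Lc ^ (0 + 1))) (wilsonA 3) κ' u')
      = e3OfK (Lc ^ (0 + 1)) (KInv (N := Lc ^ (0 + 1)) (d := 3)) (fun κ u => (cE * (cE * (Lc : ℝ) ^ (2 * (3 + 1))) ^ (0 + 1)) • wilsonA 3 κ u) := by
    funext κ' u'
    rw [e3OfK_eq_e3K, ← e3OfS_eq_e3K, e3OfS_smul_eq_push₃ (isFF_wilsonA (d := 3))]
  -- common constants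
  have hCW : 0 ≤ CW := ((hW 0) 0 0).nonneg (Sum.inl 0)
  have hC₀ : 0 ≤ C₀ := (h0 0 0).nonneg (Sum.inl 0)
  refine ⟨max ((Lc : ℝ) ^ (3 + 1) * CW) C₀, min δW δ₀, lt_min hδW hδ₀, fun k => ?_⟩
  cases k with
  | zero =>
    rw [e0]
    exact locStencil_mono' h0 (le_max_right _ _) (min_le_right _ _)
  | succ n =>
    -- `k = n + 1 ≥ 1`: the family is `Lc^4 •` row W's member `n`
    have hw : cE * (cE * (Lc : ℝ) ^ (2 * (3 + 1))) ^ (n + 1 + 1)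
        = (Lc : ℝ) ^ (3 + 1) * ((((Lc : ℝ) ^ (n + 1 + 1)) ^ (2 * (3 + 1)) * (cE * ((Lc : ℝ) ^ (3 + 1)) ^ (n + 1)))) := by
      subst hcE; ring
    have e : (fun κ' u' => (cE * (cE * (Lc : ℝ) ^ (2 * (3 + 1))) ^ (n + 1 + 1)) •
          push₃ (respStep (d := 3) 1 (Lc ^ (n + 1 + 1))) (respStep (d := 3) 1 (Lc ^ (n + 1 + 1))) (respStep (d := 3) 1 (Lc ^ (n + 1 + 1)))
            (wilsonA 3) κ' u')
        = fun κ' u' => (Lc : ℝ) ^ (3 + 1) • ((fun κ' u' => (((Lc : ℝ) ^ (n + 1 + 1)) ^ (2 * (3 + 1)) * (cE * ((Lc : ℝ) ^ (3 + 1)) ^ (n + 1))) •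
            push₃ (respStep (d := 3) 1 (Lc ^ (n + 1 + 1))) (respStep (d := 3) 1 (Lc ^ (n + 1 + 1))) (respStep (d := 3) 1 (Lc ^ (n + 1 + 1)))
              (wilsonA 3) κ' u') κ' u') := by
      funext κ' u'
      rw [hw, ← smul_smul]
    rw [e]
    have h1 := locStencil_smul ((Lc : ℝ) ^ (3 + 1)) (hW n)
    rw [abs_of_nonneg (by positivity : (0 : ℝ) ≤ (Lc : ℝ) ^ (3 + 1))] at h1
    exact locStencil_mono' h1 (le_max_left _ _) (min_le_left _ _)

end Four

end Summit.QuantumFields.BalabanUV.Beta.GAN24.WilsonSectorUndressedRow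

end
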